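import Summits.AtomisticToContinuum.HydrodynamicLimit.Theorems.CollisionIsometryCLTAdaptedWeightCLTContactBalance
import Summits.AtomisticToContinuum.HydrodynamicLimit.Theorems.CollisionIsometryCLTAdaptedWeightCLTTLPastDampingKernel

/-!
# Stub `stub_pointwise` of the line `Sketch` (contact-balance composition) for the crux
`AdaptedWeightCLT` (stmt-AtomisticToContinuum-14868; `--supports`)

POINTWISE FREE-FLIGHT INCREMENT BOUND of the block fields (`PointwiseFreeFlight γ φ` for every admissible
kernel family): pure algebra over one block. Under `freeFlight r` only the block WEIGHTS `w_i = φ_N(x_i − x)`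
move, by at most `√3 C (N+1)^{4γ} r |v_i|` each (mean value inequality on `𝕋³`, a translate by `r v` moves a
point by at most `r|v|` in the minimal-image distance), and not at all unless `x_i` or `x_i + r v_i` lies in
the block `B(x, (N+1)^{−γ})`. The block velocity is handled WITHOUT dividing:
`ρ (ū' − ū) = (ρ − ρ') ū' + (m' − m)`, `|ū|, |ū'| ≤ v_max`; the test pairings
`⟨C2 j k, y ⊗ y⟩ = y_j y_k − δ_{jk}|y|²/3`, `⟨C3 a, y^{⊗3}⟩ = ½|y|² y_a` are locally Lipschitz.
-/

namespace Summit.AtomisticToContinuum.HydrodynamicLimit.Theorems.ContactBalance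

open scoped BigOperators Topology Classical MeasureTheory ENNReal InnerProductSpace
open Filter Set MeasureTheory
open Literature.Analysis.FluidPDE
open Summit.AtomisticToContinuum.HydrodynamicLimit.Theorems.ContactSourceDuhamel
open Summit.AtomisticToContinuum.HydrodynamicLimit.Theorems.ContactSourceDuhamel.TimeLocal
open Literature.MathematicalPhysics.KineticTheory (hsDiameter localGibbsLaw empiricalDensityField
  empiricalMomentumField)

noncomputable section

namespace Pointwise

/-- `|⟨C2 j k, y ⊗ y⟩| ≤ 2 |y|²`. -/
theorem abs_pairT_C2_le (j k : Fin 3) (y : V3) : |pairT (C2 j k) (tpow 2 y)| ≤ 2 * ‖y‖ ^ 2 := by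
  have hc := fun (z : V3) (l : Fin 3) =>
    (show |z l| ≤ ‖z‖ by simpa only [Real.norm_eq_abs] using PiLp.norm_apply_le z l)
  rw [Reduction.pairT_C2_tpow, ← EuclideanSpace.real_norm_sq_eq]
  have hjk : |y j * y k| ≤ ‖y‖ ^ 2 := by
    rw [abs_mul, sq]
    exact mul_le_mul (hc y j) (hc y k) (abs_nonneg _) (norm_nonneg _)
  have h0 : 0 ≤ ‖y‖ ^ 2 := sq_nonneg _
  split_ifs
  · calc |y j * y k - ‖y‖ ^ 2 / 3| ≤ |y j * y k| + |‖y‖ ^ 2 / 3| := abs_sub _ _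
      _ ≤ ‖y‖ ^ 2 + ‖y‖ ^ 2 / 3 := by
          rw [abs_of_nonneg (by positivity : (0 : ℝ) ≤ ‖y‖ ^ 2 / 3)]; exact add_le_add hjk le_rfl
      _ ≤ 2 * ‖y‖ ^ 2 := by linarith
  · rw [sub_zero]; linarith

/-- `|⟨C2 j k, y' ⊗ y'⟩ − ⟨C2 j k, y ⊗ y⟩| ≤ 2 |y' − y| (|y'| + |y|)`. -/
theorem abs_pairT_C2_sub_le (j k : Fin 3) (y y' : V3) :
    |pairT (C2 j k) (tpow 2 y') - pairT (C2 j k) (tpow 2 y)| ≤ 2 * ‖y' - y‖ * (‖y'‖ + ‖y‖) := by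
  have hc := fun (z : V3) (l : Fin 3) =>
    (show |z l| ≤ ‖z‖ by simpa only [Real.norm_eq_abs] using PiLp.norm_apply_le z l)
  rw [Reduction.pairT_C2_tpow, Reduction.pairT_C2_tpow, ← EuclideanSpace.real_norm_sq_eq,
    ← EuclideanSpace.real_norm_sq_eq]
  have hd : ∀ l, |y' l - y l| ≤ ‖y' - y‖ := fun l => by
    rw [← PiLp.sub_apply]; exact hc _ l
  have hprod : |y' j * y' k - y j * y k| ≤ ‖y' - y‖ * (‖y'‖ + ‖y‖) := by
    have e : y' j * y' k - y j * y k = (y' j - y j) * y' k + y j * (y' k - y k) := by ring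
    rw [e]
    calc |(y' j - y j) * y' k + y j * (y' k - y k)|
        ≤ |(y' j - y j) * y' k| + |y j * (y' k - y k)| := abs_add_le _ _
      _ ≤ ‖y' - y‖ * ‖y'‖ + ‖y‖ * ‖y' - y‖ := by
          rw [abs_mul, abs_mul]
          exact add_le_add (mul_le_mul (hd j) (hc y' k) (abs_nonneg _) (norm_nonneg _))
            (mul_le_mul (hc y j) (hd k) (abs_nonneg _) (norm_nonneg _))
      _ = ‖y' - y‖ * (‖y'‖ + ‖y‖) := by ring
  have hsq : |‖y'‖ ^ 2 - ‖y‖ ^ 2| ≤ ‖y' - y‖ * (‖y'‖ + ‖y‖) := by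
    rw [sq_sub_sq, abs_mul, abs_of_nonneg (by positivity), mul_comm]
    exact mul_le_mul_of_nonneg_right (abs_norm_sub_norm_le y' y) (by positivity)
  have h0 : 0 ≤ ‖y' - y‖ * (‖y'‖ + ‖y‖) := by positivity
  split_ifs
  · have e : y' j * y' k - ‖y'‖ ^ 2 / 3 - (y j * y k - ‖y‖ ^ 2 / 3) =
        (y' j * y' k - y j * y k) - (‖y'‖ ^ 2 - ‖y‖ ^ 2) / 3 := by ring
    rw [e]
    calc |(y' j * y' k - y j * y k) - (‖y'‖ ^ 2 - ‖y‖ ^ 2) / 3|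
        ≤ |y' j * y' k - y j * y k| + |(‖y'‖ ^ 2 - ‖y‖ ^ 2) / 3| := abs_sub _ _
      _ ≤ ‖y' - y‖ * (‖y'‖ + ‖y‖) + ‖y' - y‖ * (‖y'‖ + ‖y‖) / 3 := by
          rw [abs_div, abs_of_pos (by norm_num : (0 : ℝ) < 3)]
          exact add_le_add hprod (div_le_div_of_nonneg_right hsq (by norm_num))
      _ ≤ 2 * ‖y' - y‖ * (‖y'‖ + ‖y‖) := by linarith
  · rw [sub_zero, sub_zero]; linarith

/-- `|⟨C3 a, y^{⊗3}⟩| ≤ |y|³`. -/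
theorem abs_pairT_C3_le (a : Fin 3) (y : V3) : |pairT (C3 a) (tpow 3 y)| ≤ ‖y‖ ^ 3 := by
  have hc := fun (z : V3) (l : Fin 3) =>
    (show |z l| ≤ ‖z‖ by simpa only [Real.norm_eq_abs] using PiLp.norm_apply_le z l)
  rw [Reduction.pairT_C3_tpow, ← EuclideanSpace.real_norm_sq_eq, abs_mul, abs_div,
    abs_of_nonneg (sq_nonneg _), abs_of_pos (by norm_num : (0 : ℝ) < 2)]
  have h := hc y a
  have h0 : 0 ≤ ‖y‖ ^ 2 := sq_nonneg _
  calc ‖y‖ ^ 2 / 2 * |y a| ≤ ‖y‖ ^ 2 * ‖y‖ := by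
        refine mul_le_mul (by linarith) h (abs_nonneg _) h0
    _ = ‖y‖ ^ 3 := by ring

/-- `|⟨C3 a, y'^{⊗3}⟩ − ⟨C3 a, y^{⊗3}⟩| ≤ |y' − y| (|y'| + |y|)²`. -/
theorem abs_pairT_C3_sub_le (a : Fin 3) (y y' : V3) :
    |pairT (C3 a) (tpow 3 y') - pairT (C3 a) (tpow 3 y)| ≤ ‖y' - y‖ * (‖y'‖ + ‖y‖) ^ 2 := by
  have hc := fun (z : V3) (l : Fin 3) =>
    (show |z l| ≤ ‖z‖ by simpa only [Real.norm_eq_abs] using PiLp.norm_apply_le z l)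
  rw [Reduction.pairT_C3_tpow, Reduction.pairT_C3_tpow, ← EuclideanSpace.real_norm_sq_eq,
    ← EuclideanSpace.real_norm_sq_eq]
  have hd : |y' a - y a| ≤ ‖y' - y‖ := by rw [← PiLp.sub_apply]; exact hc _ a
  have hsq : |‖y'‖ ^ 2 - ‖y‖ ^ 2| ≤ ‖y' - y‖ * (‖y'‖ + ‖y‖) := by
    rw [sq_sub_sq, abs_mul, abs_of_nonneg (by positivity), mul_comm]
    exact mul_le_mul_of_nonneg_right (abs_norm_sub_norm_le y' y) (by positivity)
  have e : ‖y'‖ ^ 2 / 2 * y' a - ‖y‖ ^ 2 / 2 * y a =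
      ((‖y'‖ ^ 2 - ‖y‖ ^ 2) * y' a + ‖y‖ ^ 2 * (y' a - y a)) / 2 := by ring
  rw [e, abs_div, abs_of_pos (by norm_num : (0 : ℝ) < 2)]
  have h1 : |(‖y'‖ ^ 2 - ‖y‖ ^ 2) * y' a| ≤ ‖y' - y‖ * (‖y'‖ + ‖y‖) * ‖y'‖ := by
    rw [abs_mul]
    exact mul_le_mul hsq (hc y' a) (abs_nonneg _) (by positivity)
  have h2 : |‖y‖ ^ 2 * (y' a - y a)| ≤ ‖y‖ ^ 2 * ‖y' - y‖ := by
    rw [abs_mul, abs_of_nonneg (sq_nonneg _)]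
    exact mul_le_mul_of_nonneg_left hd (sq_nonneg _)
  have h3 := (abs_add_le _ _).trans (add_le_add h1 h2)
  have hy : 0 ≤ ‖y‖ := norm_nonneg _
  have hy' : 0 ≤ ‖y'‖ := norm_nonneg _
  have hdn : 0 ≤ ‖y' - y‖ := norm_nonneg _
  rw [div_le_iff₀ (by norm_num : (0 : ℝ) < 2)]
  nlinarith [mul_nonneg hdn (mul_nonneg hy hy'), mul_nonneg hdn (sq_nonneg ‖y'‖),
    mul_nonneg hdn (sq_nonneg ‖y‖)]

/-- The weighted average `ū = (Σ a)⁻¹ Σ a_i v_i` of velocities of norm `≤ V` with weights `a_i ≥ 0`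
satisfies `(Σ a) ū = Σ a_i v_i` (also in the junk case `Σ a = 0`, where both vanish) and `|ū| ≤ V`. -/
theorem avg_smul_eq_and_norm_le {ι : Type*} (s : Finset ι) {a : ι → ℝ} {v : ι → V3} {V : ℝ}
    (ha : ∀ i ∈ s, 0 ≤ a i) (hv : ∀ i ∈ s, ‖v i‖ ≤ V) (hV : 0 ≤ V) :
    (∑ i ∈ s, a i) • ((∑ i ∈ s, a i)⁻¹ • ∑ i ∈ s, a i • v i) = ∑ i ∈ s, a i • v i ∧
      ‖(∑ i ∈ s, a i)⁻¹ • ∑ i ∈ s, a i • v i‖ ≤ V := by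
  have hm : ‖∑ i ∈ s, a i • v i‖ ≤ (∑ i ∈ s, a i) * V := by
    rw [Finset.sum_mul]
    refine (norm_sum_le _ _).trans (Finset.sum_le_sum fun i hi => ?_)
    rw [norm_smul, Real.norm_eq_abs, abs_of_nonneg (ha i hi)]
    exact mul_le_mul_of_nonneg_left (hv i hi) (ha i hi)
  rcases (Finset.sum_nonneg ha).eq_or_lt with h0 | hpos
  · have hm0 : ∑ i ∈ s, a i • v i = 0 := by
      rw [← norm_le_zero_iff]
      rw [← h0, zero_mul] at hm
      exact hm
    rw [hm0, smul_zero, smul_zero, norm_zero]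
    exact ⟨rfl, hV⟩
  · refine ⟨by rw [smul_smul, mul_inv_cancel₀ hpos.ne', one_smul], ?_⟩
    rw [norm_smul, norm_inv, Real.norm_eq_abs, abs_of_pos hpos, inv_mul_le_iff₀ hpos]
    exact hm

/-- The block-velocity increment WITHOUT dividing: `(Σ a) |ū' − ū| ≤ 2 V Σ_i |a_i' − a_i|`, from
`(Σ a)(ū' − ū) = (Σ_i (a_i − a_i')) ū' + Σ_i (a_i' − a_i) v_i`. -/
theorem sum_mul_norm_sub_le {ι : Type*} (s : Finset ι) {a a' : ι → ℝ} {v : ι → V3} {u u' : V3}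
    {V : ℝ} (ha : ∀ i ∈ s, 0 ≤ a i) (hv : ∀ i ∈ s, ‖v i‖ ≤ V) (hu' : ‖u'‖ ≤ V)
    (hmu : (∑ i ∈ s, a i) • u = ∑ i ∈ s, a i • v i)
    (hmu' : (∑ i ∈ s, a' i) • u' = ∑ i ∈ s, a' i • v i) :
    (∑ i ∈ s, a i) * ‖u' - u‖ ≤ 2 * V * ∑ i ∈ s, |a' i - a i| := by
  have key : (∑ i ∈ s, a i) • (u' - u) =
      (∑ i ∈ s, (a i - a' i)) • u' + ∑ i ∈ s, (a' i - a i) • v i := by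
    simp only [Finset.sum_sub_distrib, sub_smul, smul_sub, hmu, hmu']
    abel
  have hS : |∑ i ∈ s, (a i - a' i)| ≤ ∑ i ∈ s, |a' i - a i| :=
    (Finset.abs_sum_le_sum_abs _ _).trans_eq (Finset.sum_congr rfl fun i _ => abs_sub_comm _ _)
  calc (∑ i ∈ s, a i) * ‖u' - u‖ = ‖(∑ i ∈ s, a i) • (u' - u)‖ := by
        rw [norm_smul, Real.norm_eq_abs, abs_of_nonneg (Finset.sum_nonneg ha)]
    _ ≤ ‖(∑ i ∈ s, (a i - a' i)) • u'‖ + ‖∑ i ∈ s, (a' i - a i) • v i‖ := by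
        rw [key]; exact norm_add_le _ _
    _ ≤ (∑ i ∈ s, |a' i - a i|) * V + ∑ i ∈ s, |a' i - a i| * V := by
        refine add_le_add ?_ ((norm_sum_le _ _).trans (Finset.sum_le_sum fun i hi => ?_))
        · rw [norm_smul, Real.norm_eq_abs]
          exact mul_le_mul hS hu' (norm_nonneg _) (Finset.sum_nonneg fun i _ => abs_nonneg _)
        · rw [norm_smul, Real.norm_eq_abs]
          exact mul_le_mul_of_nonneg_left (hv i hi) (abs_nonneg _)
    _ = 2 * V * ∑ i ∈ s, |a' i - a i| := by rw [← Finset.sum_mul]; ring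

/-- Increment of a weighted sum of test values when the weights move from `a` to `a'` and the shift
from `u` to `u'` (the velocities do not move). -/
theorem abs_sum_mul_sub_le {ι : Type*} (s : Finset ι) {a a' : ι → ℝ} {v : ι → V3} {u u' : V3}
    (P : V3 → ℝ) {B₁ B₂ : ℝ} (ha : ∀ i ∈ s, 0 ≤ a i) (h1 : ∀ i ∈ s, |P (v i - u')| ≤ B₁)
    (h2 : ∀ i ∈ s, |P (v i - u') - P (v i - u)| ≤ B₂ * ‖u' - u‖) :
    |∑ i ∈ s, a' i * P (v i - u') - ∑ i ∈ s, a i * P (v i - u)| ≤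
      B₁ * ∑ i ∈ s, |a' i - a i| + B₂ * ((∑ i ∈ s, a i) * ‖u' - u‖) := by
  have e : ∑ i ∈ s, a' i * P (v i - u') - ∑ i ∈ s, a i * P (v i - u) =
      ∑ i ∈ s, ((a' i - a i) * P (v i - u') + a i * (P (v i - u') - P (v i - u))) := by
    rw [← Finset.sum_sub_distrib]
    exact Finset.sum_congr rfl fun i _ => by ring
  rw [e]
  calc |∑ i ∈ s, ((a' i - a i) * P (v i - u') + a i * (P (v i - u') - P (v i - u)))|
      ≤ ∑ i ∈ s, |(a' i - a i) * P (v i - u') + a i * (P (v i - u') - P (v i - u))| :=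
        Finset.abs_sum_le_sum_abs _ _
    _ ≤ ∑ i ∈ s, (|a' i - a i| * B₁ + a i * (B₂ * ‖u' - u‖)) := by
        refine Finset.sum_le_sum fun i hi => (abs_add_le _ _).trans ?_
        rw [abs_mul, abs_mul, abs_of_nonneg (ha i hi)]
        exact add_le_add (mul_le_mul_of_nonneg_left (h1 i hi) (abs_nonneg _))
          (mul_le_mul_of_nonneg_left (h2 i hi) (ha i hi))
    _ = B₁ * ∑ i ∈ s, |a' i - a i| + B₂ * ((∑ i ∈ s, a i) * ‖u' - u‖) := by
        rw [Finset.sum_add_distrib, ← Finset.sum_mul, ← Finset.sum_mul]; ring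

/-- STRESS CHANNEL, one block: the weighted sum of `⟨C2 j k, (v_i − ū)^{⊗2}⟩` moves by at most
`24 V² Σ_i |a_i' − a_i|`. -/
theorem abs_sum_C2_sub_le {ι : Type*} (s : Finset ι) {a a' : ι → ℝ} {v : ι → V3} {u u' : V3}
    {V : ℝ} (ha : ∀ i ∈ s, 0 ≤ a i) (hv : ∀ i ∈ s, ‖v i‖ ≤ V) (hu : ‖u‖ ≤ V) (hu' : ‖u'‖ ≤ V)
    (hmu : (∑ i ∈ s, a i) • u = ∑ i ∈ s, a i • v i)
    (hmu' : (∑ i ∈ s, a' i) • u' = ∑ i ∈ s, a' i • v i) (j k : Fin 3) :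
    |∑ i ∈ s, a' i * pairT (C2 j k) (tpow 2 (v i - u')) -
        ∑ i ∈ s, a i * pairT (C2 j k) (tpow 2 (v i - u))| ≤ 24 * V ^ 2 * ∑ i ∈ s, |a' i - a i| := by
  have hV : 0 ≤ V := (norm_nonneg _).trans hu
  have hy : ∀ i ∈ s, ‖v i - u‖ ≤ 2 * V := fun i hi =>
    (norm_sub_le _ _).trans (by linarith [hv i hi])
  have hy' : ∀ i ∈ s, ‖v i - u'‖ ≤ 2 * V := fun i hi =>
    (norm_sub_le _ _).trans (by linarith [hv i hi])
  have h := abs_sum_mul_sub_le s (a := a) (a' := a') (fun y => pairT (C2 j k) (tpow 2 y))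
    (B₁ := 8 * V ^ 2) (B₂ := 8 * V) ha
    (fun i hi => by
      have h2 := pow_le_pow_left₀ (norm_nonneg _) (hy' i hi) 2
      nlinarith [abs_pairT_C2_le j k (v i - u')])
    (fun i hi => by
      have h := abs_pairT_C2_sub_le j k (v i - u) (v i - u')
      rw [sub_sub_sub_cancel_left, norm_sub_rev u u'] at h
      refine h.trans ?_
      have : ‖v i - u'‖ + ‖v i - u‖ ≤ 4 * V := by linarith [hy i hi, hy' i hi]
      nlinarith [norm_nonneg (u' - u)])
  refine h.trans ?_
  have hA := sum_mul_norm_sub_le s ha hv hu' hmu hmu'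
  have hS : 0 ≤ ∑ i ∈ s, |a' i - a i| := Finset.sum_nonneg fun _ _ => abs_nonneg _
  nlinarith [hA, hS, hV, mul_le_mul_of_nonneg_left hA hV]

/-- HEAT-FLUX CHANNEL, one block: the weighted sum of `⟨C3 a, (v_i − ū)^{⊗3}⟩` moves by at most
`40 V³ Σ_i |a_i' − a_i|`. -/
theorem abs_sum_C3_sub_le {ι : Type*} (s : Finset ι) {a a' : ι → ℝ} {v : ι → V3} {u u' : V3}
    {V : ℝ} (ha : ∀ i ∈ s, 0 ≤ a i) (hv : ∀ i ∈ s, ‖v i‖ ≤ V) (hu : ‖u‖ ≤ V) (hu' : ‖u'‖ ≤ V)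
    (hmu : (∑ i ∈ s, a i) • u = ∑ i ∈ s, a i • v i)
    (hmu' : (∑ i ∈ s, a' i) • u' = ∑ i ∈ s, a' i • v i) (b : Fin 3) :
    |∑ i ∈ s, a' i * pairT (C3 b) (tpow 3 (v i - u')) -
        ∑ i ∈ s, a i * pairT (C3 b) (tpow 3 (v i - u))| ≤ 40 * V ^ 3 * ∑ i ∈ s, |a' i - a i| := by
  have hV : 0 ≤ V := (norm_nonneg _).trans hu
  have hy : ∀ i ∈ s, ‖v i - u‖ ≤ 2 * V := fun i hi =>
    (norm_sub_le _ _).trans (by linarith [hv i hi])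
  have hy' : ∀ i ∈ s, ‖v i - u'‖ ≤ 2 * V := fun i hi =>
    (norm_sub_le _ _).trans (by linarith [hv i hi])
  have h := abs_sum_mul_sub_le s (a := a) (a' := a') (fun y => pairT (C3 b) (tpow 3 y))
    (B₁ := 8 * V ^ 3) (B₂ := 16 * V ^ 2) ha
    (fun i hi => by
      have h3 := pow_le_pow_left₀ (norm_nonneg _) (hy' i hi) 3
      have := abs_pairT_C3_le b (v i - u')
      nlinarith)
    (fun i hi => by
      have h := abs_pairT_C3_sub_le b (v i - u) (v i - u')
      rw [sub_sub_sub_cancel_left, norm_sub_rev u u'] at h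
      refine h.trans ?_
      have h4 : ‖v i - u'‖ + ‖v i - u‖ ≤ 4 * V := by linarith [hy i hi, hy' i hi]
      have h16 := pow_le_pow_left₀ (by positivity) h4 2
      nlinarith [norm_nonneg (u' - u)])
  refine h.trans ?_
  have hA := sum_mul_norm_sub_le s ha hv hu' hmu hmu'
  have hS : 0 ≤ ∑ i ∈ s, |a' i - a i| := Finset.sum_nonneg fun _ _ => abs_nonneg _
  nlinarith [hA, hS, hV, mul_le_mul_of_nonneg_left hA (sq_nonneg V)]

variable {γ C : ℝ} {φ : ℕ → T3 → ℝ}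

/-- `C ≥ 0` for an admissible kernel family (`0 ≤ φ_0(0) ≤ C`). -/
theorem admissible_C_nonneg (hadm : AdmissibleKernel γ C φ) : 0 ≤ C := by
  obtain ⟨-, h0, -, -, hC, -⟩ := hadm
  simpa using (h0 0 0).trans (hC 0 0)

/-- ONE PARTICLE: translating `p` by `r v` moves the weight `φ_N(p − x)` by at most
`√3 C (N+1)^{4γ} r |v|`, and not at all unless `p` or its translate lies in the block
`B(x, (N+1)^{−γ})`. -/
theorem abs_kernel_sub_le (hadm : AdmissibleKernel γ C φ) (N : ℕ) {r : ℝ} (hr : 0 ≤ r) (x p : T3)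
    (v : V3) :
    |φ N ((Torus.geometry (Fin 3)).translate p (r • v) - x) - φ N (p - x)| ≤
      Real.sqrt 3 * (C * ((N + 1 : ℕ) : ℝ) ^ (4 * γ)) * (r * ‖v‖) *
        ((if Torus.euclidDist p x < ((N + 1 : ℕ) : ℝ) ^ (-γ) then (1 : ℝ) else 0) +
          (if Torus.euclidDist ((Torus.geometry (Fin 3)).translate p (r • v)) x <
              ((N + 1 : ℕ) : ℝ) ^ (-γ) then (1 : ℝ) else 0)) := by
  have hC0 := admissible_C_nonneg hadm
  obtain ⟨hsm, -, -, hsupp, -, hgrad⟩ := hadm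
  have hM : ((N + 1 : ℕ) : ℝ) = (N : ℝ) + 1 := Nat.cast_succ N
  have hL0 : 0 ≤ Real.sqrt 3 * (C * ((N + 1 : ℕ) : ℝ) ^ (4 * γ)) * (r * ‖v‖) := by positivity
  have hlip : |φ N ((Torus.geometry (Fin 3)).translate p (r • v) - x) - φ N (p - x)| ≤
      Real.sqrt 3 * (C * ((N + 1 : ℕ) : ℝ) ^ (4 * γ)) * (r * ‖v‖) := by
    have h1 := Torus.abs_sub_le_of_norm_gradient_le (hsm N) (hgrad N)
      ((Torus.geometry (Fin 3)).translate p (r • v) - x) (p - x)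
    have hcard : Real.sqrt (Fintype.card (Fin 3)) = Real.sqrt 3 := by norm_num
    rw [hcard, sub_sub_sub_cancel_right, ← hM] at h1
    refine h1.trans ?_
    rw [mul_assoc (Real.sqrt 3), mul_assoc (Real.sqrt 3)]
    refine mul_le_mul_of_nonneg_left (mul_le_mul_of_nonneg_left ?_ (by positivity))
      (Real.sqrt_nonneg _)
    have h := Torus.euclidDist_translate_le p p (r • v) 0
    rw [Literature.Analysis.FunctionSpaces.Torus.proj_zero, add_zero, Torus.euclidDist_self, zero_add,
      sub_zero, norm_smul, Real.norm_eq_abs, abs_of_nonneg hr] at h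
    exact (Torus.norm_sub_le_euclidDist_holds _ _).trans h
  by_cases hx : Torus.euclidDist p x < ((N + 1 : ℕ) : ℝ) ^ (-γ) ∨
      Torus.euclidDist ((Torus.geometry (Fin 3)).translate p (r • v)) x < ((N + 1 : ℕ) : ℝ) ^ (-γ)
  · refine hlip.trans (le_mul_of_one_le_right hL0 ?_)
    rcases hx with hx | hx
    · rw [if_pos hx]; split_ifs <;> norm_num
    · rw [if_pos hx]; split_ifs <;> norm_num
  · simp only [not_or, not_lt] at hx
    have hp : φ N (p - x) = 0 :=
      hsupp N _ (by rw [PastDamping.euclidDist_sub_zero, ← hM]; exact hx.1)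
    have hp' : φ N ((Torus.geometry (Fin 3)).translate p (r • v) - x) = 0 :=
      hsupp N _ (by rw [PastDamping.euclidDist_sub_zero, ← hM]; exact hx.2)
    rw [hp, hp', sub_zero, abs_zero]
    exact mul_nonneg hL0 (add_nonneg (by split_ifs <;> norm_num) (by split_ifs <;> norm_num))

/-- ALL PARTICLES: `Σ_i |w_i' − w_i| ≤ √3 C (N+1)^{4γ} r v_max (n + n')`, `n`, `n'` the numbers of
particles of `w`, `freeFlight r w` in the block. -/
theorem sum_abs_wgtC_sub_le (hadm : AdmissibleKernel γ C φ) {N : ℕ} (w : Cfg N) {r : ℝ} (hr : 0 ≤ r)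
    (x : T3) :
    ∑ i, |wgtC N φ (freeFlight (Torus.geometry (Fin 3)) r w) x i - wgtC N φ w x i| ≤
      Real.sqrt 3 * (C * ((N + 1 : ℕ) : ℝ) ^ (4 * γ)) * (r * vmax N w) *
        ((blockCount N (((N + 1 : ℕ) : ℝ) ^ (-γ)) w x : ℝ) +
          (blockCount N (((N + 1 : ℕ) : ℝ) ^ (-γ)) (freeFlight (Torus.geometry (Fin 3)) r w) x : ℝ)) := by
  have hC0 := admissible_C_nonneg hadm
  have hv : ∀ i, ‖(w i).2‖ ≤ vmax N w := fun i =>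
    Finset.le_sup' (fun i => ‖(w i).2‖) (Finset.mem_univ i)
  unfold blockCount
  rw [Finset.natCast_card_filter, Finset.natCast_card_filter, ← Finset.sum_add_distrib, Finset.mul_sum]
  refine Finset.sum_le_sum fun i _ => ?_
  have hind : (0 : ℝ) ≤ (if Torus.euclidDist (w i).1 x < ((N + 1 : ℕ) : ℝ) ^ (-γ) then (1 : ℝ) else 0) +
      (if Torus.euclidDist ((Torus.geometry (Fin 3)).translate (w i).1 (r • (w i).2)) x <
          ((N + 1 : ℕ) : ℝ) ^ (-γ) then (1 : ℝ) else 0) :=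
    add_nonneg (by split_ifs <;> norm_num) (by split_ifs <;> norm_num)
  have hL0 : 0 ≤ Real.sqrt 3 * (C * ((N + 1 : ℕ) : ℝ) ^ (4 * γ)) := by positivity
  exact (abs_kernel_sub_le hadm N hr x (w i).1 (w i).2).trans
    (mul_le_mul_of_nonneg_right (mul_le_mul_of_nonneg_left (mul_le_mul_of_nonneg_left (hv i) hr) hL0)
      hind)

/-- Finite-sum form of the block velocity of a configuration: `ū = (Σ_i w_i)⁻¹ Σ_i w_i v_i`. -/
theorem ubarC_eq (N : ℕ) (φ : ℕ → T3 → ℝ) (w : Cfg N) (x : T3) :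
    ubarC N φ w x = (∑ i, wgtC N φ w x i)⁻¹ • ∑ i, wgtC N φ w x i • (w i).2 := by
  have hM : (((N + 1 : ℕ) : ℝ)) ≠ 0 := by positivity
  unfold ubarC empiricalDensityField empiricalMomentumField
  rw [Reduction.integral_empiricalMeasure_real, Reduction.integral_empiricalMeasure_vec, smul_smul,
    mul_inv, inv_inv, mul_right_comm, mul_inv_cancel₀ hM, one_mul]
  rfl

/-- The block moments are `(N+1)⁻¹` times the weighted sums of test values. -/
theorem blkC_sub_eq (r N : ℕ) (φ : ℕ → T3 → ℝ) (w w' : Cfg N) (x : T3) (C : Tens r) :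
    blkC r N φ w' x C - blkC r N φ w x C = ((N + 1 : ℕ) : ℝ)⁻¹ *
      ((∑ i, wgtC N φ w' x i * pairT C (tpow r ((w' i).2 - ubarC N φ w' x))) -
        ∑ i, wgtC N φ w x i * pairT C (tpow r ((w i).2 - ubarC N φ w x))) := by
  rw [mul_sub]; rfl

end Pointwise

open Pointwise in
/-- STUB 1 (pointwise free-flight increments; pure algebra over one block). -/
theorem stub_pointwise : ∀ (γ C : ℝ) (φ : ℕ → T3 → ℝ), 0 < γ → γ ≤ 1 / 15 → AdmissibleKernel γ C φ →
    PointwiseFreeFlight γ φ := by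
  intro γ C φ _hγ _hγ' hadm
  refine ⟨40 * Real.sqrt 3 * C, fun N w r x hr => ?_⟩
  have hC0 := admissible_C_nonneg hadm
  have h0 : ∀ N y, 0 ≤ φ N y := hadm.2.1
  have hMinv : (0 : ℝ) ≤ ((N + 1 : ℕ) : ℝ)⁻¹ := inv_nonneg.2 (Nat.cast_nonneg _)
  have hV : 0 ≤ vmax N w :=
    (norm_nonneg _).trans (Finset.le_sup' (fun i => ‖(w i).2‖) (Finset.mem_univ 0))
  have hv : ∀ i ∈ (Finset.univ : Finset (Fin (N + 1))), ‖(w i).2‖ ≤ vmax N w := fun i _ =>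
    Finset.le_sup' (fun i => ‖(w i).2‖) (Finset.mem_univ i)
  have ha : ∀ i ∈ (Finset.univ : Finset (Fin (N + 1))), 0 ≤ wgtC N φ w x i := fun i _ => h0 N _
  have ha' : ∀ i ∈ (Finset.univ : Finset (Fin (N + 1))),
      0 ≤ wgtC N φ (freeFlight (Torus.geometry (Fin 3)) r w) x i := fun i _ => h0 N _
  have hu : ubarC N φ w x = (∑ i, wgtC N φ w x i)⁻¹ • ∑ i, wgtC N φ w x i • (w i).2 :=
    ubarC_eq N φ w x
  have hu' : ubarC N φ (freeFlight (Torus.geometry (Fin 3)) r w) x =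
      (∑ i, wgtC N φ (freeFlight (Torus.geometry (Fin 3)) r w) x i)⁻¹ •
        ∑ i, wgtC N φ (freeFlight (Torus.geometry (Fin 3)) r w) x i • (w i).2 :=
    ubarC_eq N φ (freeFlight (Torus.geometry (Fin 3)) r w) x
  obtain ⟨hmu, huV⟩ := avg_smul_eq_and_norm_le Finset.univ ha hv hV
  obtain ⟨hmu', huV'⟩ := avg_smul_eq_and_norm_le Finset.univ ha' hv hV
  rw [← hu] at hmu huV
  rw [← hu'] at hmu' huV'
  have hS := sum_abs_wgtC_sub_le hadm w hr x
  have k2 := fun j k => abs_sum_C2_sub_le Finset.univ ha hv huV huV' hmu hmu' j k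
  have k3 := fun b => abs_sum_C3_sub_le Finset.univ ha hv huV huV' hmu hmu' b
  have hV3 : vmax N w ^ 3 ≤ (1 + vmax N w) ^ 4 :=
    calc vmax N w ^ 3 ≤ (1 + vmax N w) ^ 3 := pow_le_pow_left₀ hV (by linarith) 3
      _ ≤ (1 + vmax N w) ^ 4 := pow_le_pow_right₀ (by linarith) (by norm_num)
  have hV4 : vmax N w ^ 4 ≤ (1 + vmax N w) ^ 4 := pow_le_pow_left₀ hV (by linarith) 4
  simp only [blkC_sub_eq, abs_mul, abs_of_nonneg hMinv, freeFlight_apply]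
  set M : ℝ := ((N + 1 : ℕ) : ℝ)
  set V : ℝ := vmax N w
  set L : ℝ := Real.sqrt 3 * (C * M ^ (4 * γ)) with hL
  set n : ℝ := ((blockCount N (M ^ (-γ)) w x : ℕ) : ℝ) +
    ((blockCount N (M ^ (-γ)) (freeFlight (Torus.geometry (Fin 3)) r w) x : ℕ) : ℝ)
  set S : ℝ := ∑ i, |wgtC N φ (freeFlight (Torus.geometry (Fin 3)) r w) x i - wgtC N φ w x i|
  have hK : 0 ≤ L * r * n * M⁻¹ := by positivity
  have h14 : 0 ≤ (1 + V) ^ 4 := by positivity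
  -- bookkeeping of the constants, both channels at once
  have fin : ∀ {c : ℝ} (p : ℕ) {T : ℝ}, 0 ≤ c → c * (V ^ p * V) ≤ 40 * (1 + V) ^ 4 →
      T ≤ c * V ^ p * S → M⁻¹ * T ≤ 40 * Real.sqrt 3 * C * M ^ (4 * γ) * r * (1 + V) ^ 4 * M⁻¹ * n := by
    intro c p T hc hcV hT
    calc M⁻¹ * T ≤ M⁻¹ * (c * V ^ p * S) := mul_le_mul_of_nonneg_left hT hMinv
      _ ≤ M⁻¹ * (c * V ^ p * (L * (r * V) * n)) := by gcongr
      _ = c * (V ^ p * V) * (L * r * n * M⁻¹) := by ring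
      _ ≤ 40 * (1 + V) ^ 4 * (L * r * n * M⁻¹) := mul_le_mul_of_nonneg_right hcV hK
      _ = 40 * Real.sqrt 3 * C * M ^ (4 * γ) * r * (1 + V) ^ 4 * M⁻¹ * n := by rw [hL]; ring
  exact ⟨fun j k => fin 2 (by norm_num) (by nlinarith [hV3, h14]) (k2 j k),
    fun b => fin 3 (by norm_num) (by nlinarith [hV4, h14]) (k3 b)⟩

end

end Summit.AtomisticToContinuum.HydrodynamicLimit.Theorems.ContactBalance
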